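import Summits.QuantumFields.BalabanUV.Beta.FP.ConstrainedGhostIR
import Summits.QuantumFields.BalabanUV.Beta.FP.LatticeConvolutionBounds

/-!
# Road FP (binder row D1), row H′2-IR — «IR-Q», THE VECTOR CASE OF (ε): THE ONE-SHOT REMAINDER `R^Q = A·G_C·Aᵀ` FROM DISPLAYED
# LEG LETTERS AND COARSE-INVERSE LETTERS — the multiplier letter (W) by the within-block CANCELLATION, then the superposition
# bounds (T0)∕(T1)∕(T2) with a finite direction index (generic half; our bookkeeping, no road object)

HONEST DEPENDENCY (page 1, mandatory): continuum YM on T⁴ ⇐ BetaPertH ∧ nine spine estimates (0/9 proved); BetaPertH ⇐ (D1) ∧ (D4) ∧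
CAP+tail; G-an2-4 gates asym, D1 and NE2/3/4.  HONEST FRAMING (cell contract, verbatim): «discharging `BetaPertH` makes Bałaban's UV
stability UNCONDITIONAL — a real constructive-QFT result; it is NOT the continuum limit and NOT the Clay problem.»  THIS MODULE is
[folklore] power counting on `ℤ⁴` plus ONE resolvent cancellation, over DISPLAYED hypotheses; it imports leaf-06's `FP/ConstrainedGhostIR`
(profile sums, `abs_tsum_mul_le_of_profiles`) and leaf-05-g9's `FP/LatticeConvolutionBounds` (`tsum_kernel_profile_le`,
`tsum_profile_profile_le`) BY NAME; it declares no `def`, mints no `def … : Prop`, cites nothing, has 0 `sorry`.  Every kernel below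
(`a`, `b`, `c`, `G`, `W`) is ARBITRARY: the module proves NO estimate of any Bałaban object and discharges NOTHING of row H′2-IR, of
`ρ_a`, of `hasym`, of D1 or of `BetaPertH`; NEVER «G-an2-4 closed»; NOT (CONV-C), NOT D1, NOT the continuum limit, NOT Clay.

ABSOLUTE RULE (cell charter, verbatim): «No internally-minted statement may enter as a cited fact. Every hypothesis is either
kernel-proved in this package or a verbatim quotation of a PUBLISHED theorem with page reference. The manuscript(s) under audit are NOT
citable for their own disputed steps — they are the thing under adjudication; programme-internal (2001/route/tribunal) claims are never
citable.»

THE READING (owner d1-p3-g5: `H2IR-DESIGN.md` objects `A := P Q_nᵀ`, `C_n := Q_nPQ_nᵀ`, `G_C := C_n⁻¹`, `R^Q := A G_C Aᵀ`; ruling l.21173 (ε)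
on leaf-05-g9's `ConstrainedGhostIRCoarse.W_add_delta_bound`: «THE point of the row — keep it a named lemma, H′2-IR's vector case reuses its
shape verbatim»; N7-PROOF v3.2 addendum §3′.2: these near-region letters are INPUTS to `ρ_a` through `tr(G_CQ·Qᵀ) = tr(R^Q·)`, in the currency
of E-FP-5-2 ∕ R-FP-20).  On `Pt = ℤ⁴` (sup norm `‖·‖∞`, profiles `(‖·‖∞+1)^{−s}`) with a finite direction type `ι` (`Fin 4` on the road),
fix a fine bond `(x, μ)` for the first leg and `(y, ν)` for the second; write `a α u := A((x,μ),(u,α))`, `b β v := A((y,ν),(v,β))` for the two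
legs as functions of the coarse bond, `c β v := C_n((w,ν),(v,β))` for the coarse covariance column of the block `w := quo n y` of `y`, and
`G α β u v := G_C((u,α),(v,β))`.  Then `R^Q((x,μ),(y,ν)) = Σ'_u Σ_α a α u · W α u` with the MULTIPLIER `W α u := Σ'_v Σ_β G α β u v · b β v`.
LETTERS (displayed hypotheses; suppliers named):
  (G-poly) `|G α β u v| ≤ κ∕(‖u−v‖∞+1)⁵`                               [IR-2 (v): `K·n²·e^{−δ‖u−v‖∞}` ⟹ `κ = Kn²e^δ5!∕δ⁵`, `exp_neg_supNorm_le_div_pow`];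
  (G-inv)  `∀ α u, HasSum (v ↦ Σ_β G α β u v · c β v) [u = w ∧ α = ν]`   [IR-2 (iv)(v): `G_C·C_n = 1`, with `C_n` symmetric];
  (OSC)    `|b β v − c β v| ≤ a₁∕(‖v−w‖∞+1)³`                           [IR-1: a leg at a fine point differs from its own block average by
                                                                          within-block x-differences — PART B `BlockAveragedRemainderAxial`];
  (A0)∕(A1)∕(A2) `|a α u| ≤ a₀∕(‖u−p‖∞+1)^s`, `s = 2` for the leg, `3` for its x-difference, `4` for second differences ∕ window sums   [IR-1].
CONTENT.
* §1 FINITE-DIRECTION SUPERPOSITION `abs_tsum_sum_mul_le`: `s + t ≥ 5` ⟹ `Σ'_u Σ_α a α u·W α u` summable, `≤ |ι|·162·a₀·K`.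
* §2 **THE CANCELLATION** `mult_sub_delta_bound` (the vector twin of `W_add_delta_bound`): (G-poly) ∧ (OSC) ∧ (G-inv) ⟹
  `|W α u − [u = w][α = ν]| ≤ |ι|·1296·κ·a₁∕(‖u−w‖∞+1)³`; hence (W) `abs_mult_le`: `|W α u| ≤ (|ι|·1296·κ·a₁ + 1)∕(‖u−w‖∞+1)³`.
* §3 THE REMAINDER LETTERS: (T0) `abs_rem_le_of_letters` (`s = 2`: `|R| ≤ |ι|·162·a₀·(|ι|1296κa₁+1)`), finite linear combinations of legs
  `abs_sum_rem_le_of_letters` (x-differences (T1), second differences (T2-sup): the combination's own letter of degree `s ≥ 2` is what counts),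
  and the WINDOW form `sum_abs_sum_rem_le_of_window` ((T2-win), R-FP-20: a window letter of degree 4 summed over a finite set of fine points).
Unit `b2b-balaban-gan24-formalise-leaf-04` (gen 40; cross-lane idle G-an2-4 swarm leaf seat on road FP), 2026-08-20; journal INTENT «IR-Q» l.22072.
-/

namespace Summit.QuantumFields.BalabanUV.Beta.FP.BlockAveragedRemainder

open Finset
open scoped BigOperators
open Literature.MathematicalPhysics.QuantumFieldTheory.Balaban1983to89.Beta
open Literature.MathematicalPhysics.QuantumFieldTheory.Balaban1983to89.Beta.DyadicShell (Pt supNorm supNorm_eq_zero_iff)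
open Literature.MathematicalPhysics.QuantumFieldTheory.Balaban1983to89.Beta.GradedBubbles (supNorm_neg)
open Summit.QuantumFields.BalabanUV.Beta.FP.LatticeConvolutionBounds (nonneg_of_abs_le_div tsum_kernel_profile_le
  tsum_profile_profile_le one_le_supNorm_add_one)

noncomputable section

variable {ι : Type*} [Fintype ι]

/-! ## §1 Finite-direction superposition of two profile letters -/

/-- [folklore] **SUPERPOSITION WITH A FINITE DIRECTION INDEX**: if `|a α u| ≤ a₀∕(‖u−p‖∞+1)^s` and `|W α u| ≤ K∕(‖u−w‖∞+1)^t` for every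
direction `α` with `s + t ≥ 5`, then `u ↦ Σ_α a α u·W α u` is summable on `ℤ⁴` and `|Σ'_u Σ_α a α u·W α u| ≤ |ι|·162·a₀·K` — for ALL centres
`p, w` (no near-region restriction; `tsum_profile_profile_le` per direction). -/
theorem abs_tsum_sum_mul_le {a W : ι → Pt → ℝ} {a₀ K : ℝ} {s t : ℕ} (hst : 5 ≤ s + t) (p w : Pt)
    (ha : ∀ α u, |a α u| ≤ a₀ / ((supNorm (u - p) : ℝ) + 1) ^ s)
    (hW : ∀ α u, |W α u| ≤ K / ((supNorm (u - w) : ℝ) + 1) ^ t) :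
    Summable (fun u => ∑ α, a α u * W α u)
      ∧ |∑' u, ∑ α, a α u * W α u| ≤ (Fintype.card ι : ℝ) * 162 * a₀ * K := by
  have hα : ∀ α, Summable (fun u => a α u * W α u) ∧ |∑' u, a α u * W α u| ≤ a₀ * K * 162 :=
    fun α => tsum_profile_profile_le p w hst (ha α) (hW α)
  have hsum : Summable (fun u => ∑ α, a α u * W α u) := summable_sum fun α _ => (hα α).1
  refine ⟨hsum, ?_⟩
  rw [Summable.tsum_finsetSum fun α _ => (hα α).1]
  calc |∑ α, ∑' u, a α u * W α u| ≤ ∑ α, |∑' u, a α u * W α u| := Finset.abs_sum_le_sum_abs _ _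
    _ ≤ ∑ _α : ι, a₀ * K * 162 := Finset.sum_le_sum fun α _ => (hα α).2
    _ = (Fintype.card ι : ℝ) * 162 * a₀ * K := by rw [Finset.sum_const, nsmul_eq_mul, Finset.card_univ]; ring

/-- [folklore] Pointwise form used for window sums: `Σ_α |a α u|·|W α u|` has the same bound `|ι|·162·a₀·K` on its series. -/
theorem tsum_sum_abs_mul_le {a W : ι → Pt → ℝ} {a₀ K : ℝ} {s t : ℕ} (hst : 5 ≤ s + t) (p w : Pt)
    (ha : ∀ α u, |a α u| ≤ a₀ / ((supNorm (u - p) : ℝ) + 1) ^ s)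
    (hW : ∀ α u, |W α u| ≤ K / ((supNorm (u - w) : ℝ) + 1) ^ t) :
    Summable (fun u => ∑ α, |a α u| * |W α u|)
      ∧ ∑' u, ∑ α, |a α u| * |W α u| ≤ (Fintype.card ι : ℝ) * 162 * a₀ * K := by
  have ha' : ∀ α u, |(|a α u|)| ≤ a₀ / ((supNorm (u - p) : ℝ) + 1) ^ s := fun α u => by rw [abs_abs]; exact ha α u
  have hW' : ∀ α u, |(|W α u|)| ≤ K / ((supNorm (u - w) : ℝ) + 1) ^ t := fun α u => by rw [abs_abs]; exact hW α u
  have h := abs_tsum_sum_mul_le hst p w ha' hW'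
  refine ⟨h.1, le_trans (le_abs_self _) h.2⟩

/-! ## §2 The cancellation: the multiplier minus the block-diagonal δ has a degree-3 profile -/

/-- [folklore] **THE WITHIN-BLOCK CANCELLATION, VECTOR CASE** (twin of `ConstrainedGhostIRCoarse.W_add_delta_bound`).  A `5`-polynomially
local coarse kernel `G` (G-poly) which inverts the block-averaged column `c` of the leg (G-inv: `Σ'_v Σ_β G α β u v·c β v = [u = w][α = ν]`),
applied to the leg `b` itself, differs from the block-diagonal `δ` by `G` applied to the WITHIN-BLOCK OSCILLATION `b − c` (OSC, degree 3), and
a degree-5 kernel reproduces a degree-3 profile (`tsum_kernel_profile_le`):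
`|Σ'_v Σ_β G α β u v·b β v − [u = w ∧ α = ν]| ≤ |ι|·1296·κ·a₁∕(‖u−w‖∞+1)³`. -/
theorem mult_sub_delta_bound [DecidableEq ι] {G : ι → ι → Pt → Pt → ℝ} {b c : ι → Pt → ℝ} {κ a₁ : ℝ} {w : Pt} {ν : ι}
    (hG : ∀ α β u v, |G α β u v| ≤ κ / ((supNorm (u - v) : ℝ) + 1) ^ 5)
    (hosc : ∀ β v, |b β v - c β v| ≤ a₁ / ((supNorm (v - w) : ℝ) + 1) ^ 3)
    (hinv : ∀ α u, HasSum (fun v => ∑ β, G α β u v * c β v) (if u = w ∧ α = ν then 1 else 0))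
    (α : ι) (u : Pt) :
    Summable (fun v => ∑ β, G α β u v * b β v)
      ∧ |∑' v, ∑ β, G α β u v * b β v - (if u = w ∧ α = ν then 1 else 0)|
          ≤ (Fintype.card ι : ℝ) * 1296 * κ * a₁ / ((supNorm (u - w) : ℝ) + 1) ^ 3 := by
  -- the oscillation part, direction by direction
  have hG' : ∀ β v, |G α β u v| ≤ κ / ((supNorm (v - u) : ℝ) + 1) ^ 5 := fun β v => by
    rw [← supNorm_neg, neg_sub]; exact hG α β u v
  have hβ : ∀ β, Summable (fun v => G α β u v * (b β v - c β v))
      ∧ |∑' v, G α β u v * (b β v - c β v)| ≤ κ * a₁ * (162 * (2 / ((supNorm (u - w) : ℝ) + 2)) ^ 3) :=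
    fun β => tsum_kernel_profile_le u w (le_refl 5) (by norm_num : 3 ≤ 5) (hG' β) (hosc β)
  have hoscS : Summable (fun v => ∑ β, G α β u v * (b β v - c β v)) := summable_sum fun β _ => (hβ β).1
  have hcS : Summable (fun v => ∑ β, G α β u v * c β v) := (hinv α u).summable
  have hsplit : (fun v => ∑ β, G α β u v * b β v)
      = fun v => (∑ β, G α β u v * c β v) + ∑ β, G α β u v * (b β v - c β v) := by
    funext v; rw [← Finset.sum_add_distrib]; refine Finset.sum_congr rfl fun β _ => ?_; ring
  have hbS : Summable (fun v => ∑ β, G α β u v * b β v) := by rw [hsplit]; exact hcS.add hoscS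
  refine ⟨hbS, ?_⟩
  have hid : ∑' v, ∑ β, G α β u v * b β v - (if u = w ∧ α = ν then 1 else 0) = ∑' v, ∑ β, G α β u v * (b β v - c β v) := by
    rw [hsplit, hcS.tsum_add hoscS, (hinv α u).tsum_eq]; ring
  rw [hid, Summable.tsum_finsetSum fun β _ => (hβ β).1]
  refine (Finset.abs_sum_le_sum_abs _ _).trans ?_
  have hκ : 0 ≤ κ := by
    have h := nonneg_of_abs_le_div (f := fun v => G α α u v) (p := u) (a := 5) u (hG' α u)
    exact h
  have ha₁ : 0 ≤ a₁ := nonneg_of_abs_le_div (f := fun v => b α v - c α v) (p := w) (a := 3) w (hosc α w)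
  have hm : (0 : ℝ) ≤ (supNorm (u - w) : ℝ) := Nat.cast_nonneg _
  -- `κ·a₁·(162·(2/(m+2))³) ≤ 1296·κ·a₁/(m+1)³`
  have key : κ * a₁ * (162 * (2 / ((supNorm (u - w) : ℝ) + 2)) ^ 3) ≤ 1296 * κ * a₁ / ((supNorm (u - w) : ℝ) + 1) ^ 3 := by
    rw [div_pow, show (2 : ℝ) ^ 3 = 8 by norm_num]
    have k1 : 162 * (8 / (((supNorm (u - w) : ℝ) + 2) ^ 3)) ≤ 1296 / ((supNorm (u - w) : ℝ) + 1) ^ 3 := by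
      rw [mul_div_assoc', show (162 : ℝ) * 8 = 1296 by norm_num]
      apply div_le_div_of_nonneg_left (by norm_num) (by positivity)
      gcongr; norm_num
    calc κ * a₁ * (162 * (8 / ((supNorm (u - w) : ℝ) + 2) ^ 3))
        ≤ κ * a₁ * (1296 / ((supNorm (u - w) : ℝ) + 1) ^ 3) := mul_le_mul_of_nonneg_left k1 (mul_nonneg hκ ha₁)
      _ = 1296 * κ * a₁ / ((supNorm (u - w) : ℝ) + 1) ^ 3 := by ring
  calc ∑ β, |∑' v, G α β u v * (b β v - c β v)|
      ≤ ∑ _β : ι, 1296 * κ * a₁ / ((supNorm (u - w) : ℝ) + 1) ^ 3 := Finset.sum_le_sum fun β _ => ((hβ β).2).trans key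
    _ = (Fintype.card ι : ℝ) * 1296 * κ * a₁ / ((supNorm (u - w) : ℝ) + 1) ^ 3 := by
        rw [Finset.sum_const, nsmul_eq_mul, Finset.card_univ]; ring

/-- [folklore] **THE MULTIPLIER LETTER (W)**: under (G-poly), (OSC), (G-inv),
`|Σ'_v Σ_β G α β u v·b β v| ≤ (|ι|·1296·κ·a₁ + 1)∕(‖u−w‖∞+1)³` — the `+1` is the block-diagonal `δ` (twin of `abs_Ws_le_of_coarseInv`). -/
theorem abs_mult_le [DecidableEq ι] {G : ι → ι → Pt → Pt → ℝ} {b c : ι → Pt → ℝ} {κ a₁ : ℝ} {w : Pt} {ν : ι}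
    (hG : ∀ α β u v, |G α β u v| ≤ κ / ((supNorm (u - v) : ℝ) + 1) ^ 5)
    (hosc : ∀ β v, |b β v - c β v| ≤ a₁ / ((supNorm (v - w) : ℝ) + 1) ^ 3)
    (hinv : ∀ α u, HasSum (fun v => ∑ β, G α β u v * c β v) (if u = w ∧ α = ν then 1 else 0))
    (α : ι) (u : Pt) :
    |∑' v, ∑ β, G α β u v * b β v| ≤ ((Fintype.card ι : ℝ) * 1296 * κ * a₁ + 1) / ((supNorm (u - w) : ℝ) + 1) ^ 3 := by
  have h := (mult_sub_delta_bound hG hosc hinv α u).2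
  set m : ℝ := (supNorm (u - w) : ℝ) + 1 with hm
  have hm0 : 0 < m := by positivity
  have hδ : |(if u = w ∧ α = ν then (1 : ℝ) else 0)| ≤ 1 / m ^ 3 := by
    split_ifs with huw
    · have : m = 1 := by rw [hm, huw.1, sub_self, supNorm_eq_zero_iff.mpr rfl]; norm_num
      rw [this]; norm_num
    · rw [abs_zero]; positivity
  calc |∑' v, ∑ β, G α β u v * b β v|
      = |(∑' v, ∑ β, G α β u v * b β v - (if u = w ∧ α = ν then 1 else 0)) + (if u = w ∧ α = ν then 1 else 0)| := by
        rw [sub_add_cancel]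
    _ ≤ |∑' v, ∑ β, G α β u v * b β v - (if u = w ∧ α = ν then 1 else 0)| + |(if u = w ∧ α = ν then (1 : ℝ) else 0)| :=
        abs_add_le _ _
    _ ≤ (Fintype.card ι : ℝ) * 1296 * κ * a₁ / m ^ 3 + 1 / m ^ 3 := add_le_add h hδ
    _ = ((Fintype.card ι : ℝ) * 1296 * κ * a₁ + 1) / m ^ 3 := by rw [← add_div]

/-! ## §3 The remainder letters (T0)∕(T1)∕(T2) -/

/-- **(T0) THE REMAINDER FROM THE LETTERS** [folklore]: a leg letter of degree `s ≥ 2` at the first fine bond (A0: `|a α u| ≤ a₀∕(‖u−p‖∞+1)^s`)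
and the multiplier's letters at the second ((G-poly), (OSC), (G-inv)) give, for ALL `p, w` (global, like IR-4's (T0)),
`|Σ'_u Σ_α a α u·(Σ'_v Σ_β G α β u v·b β v)| ≤ |ι|·162·a₀·(|ι|·1296·κ·a₁ + 1)`.  With the road's scalings `a₀ ≍ C₀n⁻²`, `κ ≍ Kn²`,
`a₁ ≍ C₁n⁻²` this is `≍ n⁻²` = E-FP-5-2's `n^{2−d}`. -/
theorem abs_rem_le_of_letters [DecidableEq ι] {a : ι → Pt → ℝ} {G : ι → ι → Pt → Pt → ℝ} {b c : ι → Pt → ℝ} {a₀ κ a₁ : ℝ} {p w : Pt} {ν : ι}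
    {s : ℕ} (hs : 2 ≤ s)
    (ha : ∀ α u, |a α u| ≤ a₀ / ((supNorm (u - p) : ℝ) + 1) ^ s)
    (hG : ∀ α β u v, |G α β u v| ≤ κ / ((supNorm (u - v) : ℝ) + 1) ^ 5)
    (hosc : ∀ β v, |b β v - c β v| ≤ a₁ / ((supNorm (v - w) : ℝ) + 1) ^ 3)
    (hinv : ∀ α u, HasSum (fun v => ∑ β, G α β u v * c β v) (if u = w ∧ α = ν then 1 else 0)) :
    Summable (fun u => ∑ α, a α u * ∑' v, ∑ β, G α β u v * b β v)
      ∧ |∑' u, ∑ α, a α u * ∑' v, ∑ β, G α β u v * b β v|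
          ≤ (Fintype.card ι : ℝ) * 162 * a₀ * ((Fintype.card ι : ℝ) * 1296 * κ * a₁ + 1) :=
  abs_tsum_sum_mul_le (W := fun α u => ∑' v, ∑ β, G α β u v * b β v) (t := 3) (by omega) p w ha
    (fun α u => abs_mult_le hG hosc hinv α u)

/-- **(T1)∕(T2-sup) FINITE COMBINATIONS OF LEGS** [folklore]: for legs `leg k` (`k ∈ Fin m`; e.g. the leg at `x`, `x+e_i`, `x+e_j`, `x+e_i+e_j`)
each with a degree-2 letter (summability) and real coefficients `coef`, the combination `Σ_k coef k·leg k` carrying ITS OWN letter of degree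
`s ≥ 2` with constant `aS` (x-differences: `s = 3`, `aS ≍ C₁n⁻³`; second differences: `s = 4`, sup constant possibly `(1 + log n)`-carrying),
`|Σ_k coef k·R_k| ≤ |ι|·162·aS·K_W` where `R_k := Σ'_u Σ_α leg k α u·W α u` and `K_W` is the multiplier constant of (W). -/
theorem abs_sum_rem_le_of_letters {m : ℕ} (coef : Fin m → ℝ) (leg : Fin m → ι → Pt → ℝ) {W : ι → Pt → ℝ}
    {a₀ aS K : ℝ} {p w : Pt} {s : ℕ} (hs : 2 ≤ s)
    (hleg : ∀ k α u, |leg k α u| ≤ a₀ / ((supNorm (u - p) : ℝ) + 1) ^ 2)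
    (hcomb : ∀ α u, |∑ k, coef k * leg k α u| ≤ aS / ((supNorm (u - p) : ℝ) + 1) ^ s)
    (hW : ∀ α u, |W α u| ≤ K / ((supNorm (u - w) : ℝ) + 1) ^ 3) :
    |∑ k, coef k * ∑' u, ∑ α, leg k α u * W α u| ≤ (Fintype.card ι : ℝ) * 162 * aS * K := by
  have hk : ∀ k, Summable (fun u => ∑ α, leg k α u * W α u) :=
    fun k => (abs_tsum_sum_mul_le (s := 2) (t := 3) (by norm_num) p w (hleg k) hW).1
  have hswap : ∑ k, coef k * ∑' u, ∑ α, leg k α u * W α u = ∑' u, ∑ α, (∑ k, coef k * leg k α u) * W α u := by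
    have h1 : ∀ k, coef k * ∑' u, ∑ α, leg k α u * W α u = ∑' u, coef k * ∑ α, leg k α u * W α u :=
      fun k => (tsum_mul_left).symm
    simp_rw [h1]
    rw [← Summable.tsum_finsetSum fun k _ => (hk k).mul_left (coef k)]
    refine tsum_congr fun u => ?_
    simp_rw [Finset.mul_sum, Finset.sum_mul]
    rw [Finset.sum_comm]
    refine Finset.sum_congr rfl fun α _ => Finset.sum_congr rfl fun k _ => ?_
    ring
  rw [hswap]
  exact (abs_tsum_sum_mul_le (a := fun α u => ∑ k, coef k * leg k α u) (t := 3) (by omega) p w hcomb hW).2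

/-- **(T2-win) THE WINDOW FORM** (R-FP-20) [folklore]: for a finite set `X` of fine points with legs `leg x k` and a WINDOW letter of degree 4
for the combination (`Σ_{x∈X} |Σ_k coef k·leg x k α u| ≤ aW∕(‖u−p‖∞+1)⁴` — log-free on the road, IR-1's averaged (D2)), the window sum of the
combined remainders obeys `Σ_{x∈X} |Σ_k coef k·R_{x,k}| ≤ |ι|·162·aW·K_W`. -/
theorem sum_abs_sum_rem_le_of_window {m : ℕ} (X : Finset Pt) (coef : Fin m → ℝ) (leg : Pt → Fin m → ι → Pt → ℝ)
    {W : ι → Pt → ℝ} {a₀ aW K : ℝ} {p w : Pt}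
    (hleg : ∀ x k α u, |leg x k α u| ≤ a₀ / ((supNorm (u - p) : ℝ) + 1) ^ 2)
    (hwin : ∀ α u, ∑ x ∈ X, |∑ k, coef k * leg x k α u| ≤ aW / ((supNorm (u - p) : ℝ) + 1) ^ 4)
    (hW : ∀ α u, |W α u| ≤ K / ((supNorm (u - w) : ℝ) + 1) ^ 3) :
    ∑ x ∈ X, |∑ k, coef k * ∑' u, ∑ α, leg x k α u * W α u| ≤ (Fintype.card ι : ℝ) * 162 * aW * K := by
  -- each combined remainder as ONE series
  have hk : ∀ x k, Summable (fun u => ∑ α, leg x k α u * W α u) :=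
    fun x k => (abs_tsum_sum_mul_le (s := 2) (t := 3) (by norm_num) p w (hleg x k) hW).1
  have hswap : ∀ x, ∑ k, coef k * ∑' u, ∑ α, leg x k α u * W α u = ∑' u, ∑ α, (∑ k, coef k * leg x k α u) * W α u := by
    intro x
    have h1 : ∀ k, coef k * ∑' u, ∑ α, leg x k α u * W α u = ∑' u, coef k * ∑ α, leg x k α u * W α u :=
      fun k => (tsum_mul_left).symm
    simp_rw [h1]
    rw [← Summable.tsum_finsetSum fun k _ => (hk x k).mul_left (coef k)]
    refine tsum_congr fun u => ?_
    simp_rw [Finset.mul_sum, Finset.sum_mul]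
    rw [Finset.sum_comm]
    refine Finset.sum_congr rfl fun α _ => Finset.sum_congr rfl fun k _ => ?_
    ring
  -- a pointwise degree-4 letter for each `x ∈ X`
  have hcombx : ∀ x ∈ X, ∀ α u, |∑ k, coef k * leg x k α u| ≤ aW / ((supNorm (u - p) : ℝ) + 1) ^ 4 := by
    intro x hx α u
    exact (Finset.single_le_sum (f := fun x => |∑ k, coef k * leg x k α u|) (fun _ _ => abs_nonneg _) hx).trans (hwin α u)
  -- pointwise majorant series `u ↦ Σ_α (Σ_x |comb_x α u|)·|W α u|`
  set F : ι → Pt → ℝ := fun α u => ∑ x ∈ X, |∑ k, coef k * leg x k α u| with hF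
  have hFle : ∀ α u, |F α u| ≤ aW / ((supNorm (u - p) : ℝ) + 1) ^ 4 := fun α u => by
    rw [hF, abs_of_nonneg (Finset.sum_nonneg fun _ _ => abs_nonneg _)]; exact hwin α u
  have hmaj := tsum_sum_abs_mul_le (s := 4) (t := 3) (by norm_num) p w hFle hW
  -- each `|R_x| ≤ Σ'_u Σ_α |comb_x α u|·|W α u|`
  have hx : ∀ x ∈ X, Summable (fun u => ∑ α, |∑ k, coef k * leg x k α u| * |W α u|)
      ∧ |∑' u, ∑ α, (∑ k, coef k * leg x k α u) * W α u| ≤ ∑' u, ∑ α, |∑ k, coef k * leg x k α u| * |W α u| := by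
    intro x hxX
    have hs := tsum_sum_abs_mul_le (s := 4) (t := 3) (by norm_num) p w (hcombx x hxX) hW
    refine ⟨hs.1, ?_⟩
    have hsum := (abs_tsum_sum_mul_le (a := fun α u => ∑ k, coef k * leg x k α u) (s := 4) (t := 3) (by norm_num) p w
      (hcombx x hxX) hW).1
    calc |∑' u, ∑ α, (∑ k, coef k * leg x k α u) * W α u| = ‖∑' u, ∑ α, (∑ k, coef k * leg x k α u) * W α u‖ := (Real.norm_eq_abs _).symm
      _ ≤ ∑' u, ‖∑ α, (∑ k, coef k * leg x k α u) * W α u‖ := norm_tsum_le_tsum_norm hsum.norm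
      _ ≤ ∑' u, ∑ α, |∑ k, coef k * leg x k α u| * |W α u| := by
          refine hsum.norm.tsum_le_tsum (fun u => ?_) hs.1
          rw [Real.norm_eq_abs]
          refine (Finset.abs_sum_le_sum_abs _ _).trans (le_of_eq ?_)
          exact Finset.sum_congr rfl fun α _ => abs_mul _ _
  calc ∑ x ∈ X, |∑ k, coef k * ∑' u, ∑ α, leg x k α u * W α u|
      = ∑ x ∈ X, |∑' u, ∑ α, (∑ k, coef k * leg x k α u) * W α u| := Finset.sum_congr rfl fun x _ => by rw [hswap x]
    _ ≤ ∑ x ∈ X, ∑' u, ∑ α, |∑ k, coef k * leg x k α u| * |W α u| := Finset.sum_le_sum fun x hxX => (hx x hxX).2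
    _ = ∑' u, ∑ x ∈ X, ∑ α, |∑ k, coef k * leg x k α u| * |W α u| :=
        (Summable.tsum_finsetSum fun x hxX => (hx x hxX).1).symm
    _ = ∑' u, ∑ α, |F α u| * |W α u| := by
        refine tsum_congr fun u => ?_
        rw [Finset.sum_comm]
        refine Finset.sum_congr rfl fun α _ => ?_
        have hFabs : |F α u| = ∑ x ∈ X, |∑ k, coef k * leg x k α u| := by
          rw [hF]; exact abs_of_nonneg (Finset.sum_nonneg fun _ _ => abs_nonneg _)
        rw [hFabs, Finset.sum_mul]
    _ ≤ (Fintype.card ι : ℝ) * 162 * aW * K := hmaj.2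

end

end Summit.QuantumFields.BalabanUV.Beta.FP.BlockAveragedRemainder
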